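import Summits.ResolutionOfSingularities.ResolutionOfSingularities.Theorems.FrobeniusLadderFInjectiveMacaulayficationGDDDefs
import Summits.ResolutionOfSingularities.ResolutionOfSingularities.Theorems.FrobeniusLadderFInjectiveMacaulayficationEmbeddedSncThreefolds
import Mathlib.RingTheory.IntegralClosure.IntegrallyClosed
import Mathlib.RingTheory.KrullDimension.Field
import HarnessLib

/-!
# ThmD-3 from COR D1: GDD at an isolated normal quasi-excellent threefold singularity
# (crux `FInjectiveMacaulayfication` stmt-ResolutionOfSingularities-15315, chain w45a; task (C) STEP 1, RULING R15.36 (2) / R15.38)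

[OURS · L1 W4.5a · res-L1-w45a-lead-1] Helper theorem toward the residual-class census (ThmD-≤3, THEOREM-D programme of
res-L1-w45a-idea-1 / strat-1); NOT a door rung, NOT a statement of any manuscript; AI-written, weaker than expert review.

* `gdd_of_isolatedSingularity_dimThree_of (hD) (hG) (h081R) (hP) (hCJS)` — an ISOLATED normal singular point of a quasi-excellent
  local threefold `A` of characteristic `p` (`A` a Noetherian integrally closed local domain, `Spec A` quasi-excellent,
  `dim A = 3`, `A_𝔮` regular for every prime `𝔮 ≠ 𝔪`) has GDD (`GDD p A`, `…Theorems.FInjectiveMacaulayfication.GDD`,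
  p558261), modulo BY NAME the four printed threefold theorems `CossartPiltant2019General` (CP 2019 Thm. 1.1 (i)(ii)), `Stacks081R`
  (Raynaud–Gruson flattening), `CossartPiltant2019Principalization` (CP 2019 Prop. 4.4), `CossartJannsenSaito2020EmbeddedSequenceB`
  (CJS 2020 Thm. 1.4), and BY TEXT COR D1 `hD` (= idea-1's `gdd_of_sncBlowupModel`, the content of THEOREM-D: an `𝔪`-supported
  blowing up of `Spec A` with regular total space and snc fibre over `𝔪` yields GDD).
  KNOWN composition: (1) `Spec A` is an integral separated Noetherian quasi-excellent scheme of dimension three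
  (`PrimeSpectrum.topologicalKrullDim_eq_ringKrullDim`); (2) Cossart–Piltant by one blowing up
  (`CP2019.exists_isBlowup_isRegular_of_dim_three_of_isQuasiExcellent`): `ρ₁ : T → Spec A` along `𝓛₁ ≠ 0`, `T` regular,
  `Supp 𝓛₁ ⊆ Sing (Spec A) ⊆ {𝔪}` (`hiso` + `regularLocus_Spec_eq`) — no case split when `A` is regular (then `Supp 𝓛₁ = ∅`);
  (3) `T` integral Noetherian regular excellent of dimension three, `B := ρ₁⁻¹{𝔪} ⊊ T` closed (the generic point maps to
  `(0) ≠ 𝔪` as `dim A = 3`); (4) STEP 2 `EmbeddedSncThreefolds.embeddedSncThreefolds_of hP hCJS` (p561818): `ρ₂ : X' → T` one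
  blowing up along `𝓛₂`, `Supp 𝓛₂ ⊆ B`, `X'` regular, `ρ₂⁻¹B` snc; (5) `IsBlowup.exists_isBlowup_comp_supported`: `ρ₂ ≫ ρ₁`
  is one blowing up along some `𝓛 ≠ 0` with `Supp 𝓛 ⊆ {𝔪}`, and `(ρ₂ ≫ ρ₁)⁻¹{𝔪} = ρ₂⁻¹B`; (6) `hD`.
-/

-- single-problem summit: the doubled namespace component is forced
set_option linter.dupNamespace false
set_option autoImplicit false

noncomputable section

open CategoryTheory CategoryTheory.Limits AlgebraicGeometry TopologicalSpace IsLocalRing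
open Literature.AlgebraicGeometry.Resolution Literature.AlgebraicGeometry.CossartPiltant200819
open Literature.AlgebraicGeometry.CossartPiltant200819.CP2019
open Scheme.IdealSheafData

namespace Summit.ResolutionOfSingularities.ResolutionOfSingularities.Theorems.FInjectiveMacaulayfication.GDDOfIsolatedDimThree

open Summit.ResolutionOfSingularities.ResolutionOfSingularities.Theorems.FInjectiveMacaulayfication
open Summit.ResolutionOfSingularities.ResolutionOfSingularities.Theorems.FInjectiveMacaulayfication.GDD

/-- The generic point `(0)` of the spectrum of a local domain of Krull dimension three is not the closed point `𝔪`
(`𝔪 = 0` would make `A` a field, of dimension `0`). [folklore] -/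
theorem genericPoint_ne_closedPoint (A : Type) [CommRing A] [IsDomain A] [IsLocalRing A]
    (hdim : ringKrullDim A = (3 : ℕ)) :
    genericPoint (Spec (.of A)) ≠ IsLocalRing.closedPoint A := by
  intro h
  have h1 : (⊥ : Ideal A) = maximalIdeal A := by
    have h2 := congrArg PrimeSpectrum.asIdeal h
    rw [genericPoint_eq_bot_of_affine] at h2
    exact h2
  have hF : IsField A := IsLocalRing.isField_iff_maximalIdeal_eq.mpr h1.symm
  have h0 := ringKrullDim_eq_zero_of_isField hF
  rw [hdim] at h0
  exact absurd h0 (by norm_num)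

/-- **ThmD-3 from COR D1 (task (C) STEP 1).**  Let `A` be a Noetherian integrally closed local domain of characteristic `p` with
`Spec A` quasi-excellent, `dim A = 3`, and `A_𝔮` regular for every prime ideal `𝔮 ≠ 𝔪` (an isolated normal threefold
singularity).  Then `A` has GDD — given BY NAME Cossart–Piltant 2019 Thm. 1.1 (i)(ii) (`CossartPiltant2019General`), Raynaud–Gruson
flattening (`Stacks081R`), Cossart–Piltant 2019 Prop. 4.4 (`CossartPiltant2019Principalization`), Cossart–Jannsen–Saito 2020 Thm. 1.4
(`CossartJannsenSaito2020EmbeddedSequenceB`), and BY TEXT the hypothesis `hD` = COR D1 of the THEOREM-D programme («an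
`𝔪`-supported blowing up `π : X' → Spec A` along `𝓛 ≠ 0` with `X'` regular and `π⁻¹{𝔪}` a strict normal crossings divisor gives
`GDD p A`», idea-1's `gdd_of_sncBlowupModel`, OURS and unproved here).  The composition (1)–(6) of the module docstring.
[OURS · L1 W4.5a helper toward ThmD-≤3; KNOWN assembly modulo `hD`; cite: CossartPiltant2019, Thm. 1.1, Prop. 4.4; CossartJannsenSaito2020, Thm. 1.4] -/
theorem gdd_of_isolatedSingularity_dimThree_of
    (hD : ∀ (p : ℕ) [Fact p.Prime] (A : Type) [CommRing A] [IsDomain A] [IsNoetherianRing A] [IsLocalRing A] [IsIntegrallyClosed A]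
        [CharP A p] (X' : Scheme.{0}) (π : X' ⟶ Spec (.of A)) (𝓛 : (Spec (.of A)).IdealSheafData),
        𝓛 ≠ ⊥ → (𝓛.support : Set (Spec (.of A))) ⊆ {IsLocalRing.closedPoint A} → IsBlowup π 𝓛 → Scheme.IsRegular X' →
        IsStrictNormalCrossingsDivisor X' (π ⁻¹' {IsLocalRing.closedPoint A}) → GDD p A)
    (hG : CossartPiltant2019General.{0}) (h081R : Stacks081R.{0}) (hP : CossartPiltant2019Principalization.{0})
    (hCJS : CossartJannsenSaito2020EmbeddedSequenceB.{0}) (p : ℕ) [Fact p.Prime]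
    (A : Type) [CommRing A] [IsDomain A] [IsNoetherianRing A] [IsLocalRing A] [IsIntegrallyClosed A] [CharP A p]
    (hqe : Scheme.IsQuasiExcellent (Spec (.of A))) (hdim : ringKrullDim A = (3 : ℕ))
    (hiso : ∀ (𝔮 : Ideal A) [𝔮.IsPrime], 𝔮 ≠ IsLocalRing.maximalIdeal A → IsRegularLocalRing (Localization.AtPrime 𝔮)) :
    GDD p A := by
  classical
  set X : Scheme.{0} := Spec (.of A) with hXdef
  -- (1) `dim (Spec A) = 3`
  have hdimX : topologicalKrullDim X = 3 := by
    have h := PrimeSpectrum.topologicalKrullDim_eq_ringKrullDim (R := A)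
    rw [hdim] at h
    exact_mod_cast h
  have hgen : genericPoint X ≠ IsLocalRing.closedPoint A := genericPoint_ne_closedPoint A hdim
  -- (2) Cossart–Piltant: one blowing up `ρ₁ : T → Spec A` along `𝓛₁ ≠ 0`, `T` regular, `Supp 𝓛₁ ⊆ Sing (Spec A)`
  obtain ⟨𝓛₁, T, ρ₁, h𝓛₁ne, hρ₁, hTreg, U, hU, h𝓛₁supp, hisoU⟩ :=
    exists_isBlowup_isRegular_of_dim_three_of_isQuasiExcellent hG h081R hP (X := X) hqe hdimX
  haveI := hisoU
  -- `Sing (Spec A) ⊆ {𝔪}` (the singularity is isolated)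
  have hUc : (U : Set X)ᶜ ⊆ {IsLocalRing.closedPoint A} := by
    intro x hx
    show x = IsLocalRing.closedPoint A
    by_contra hne
    apply hx
    rw [hU, regularLocus_Spec_eq, Set.mem_setOf_eq]
    refine hiso x.asIdeal ?_
    intro h𝔮
    exact hne (PrimeSpectrum.ext h𝔮)
  have h𝓛₁pt : (𝓛₁.support : Set X) ⊆ {IsLocalRing.closedPoint A} := h𝓛₁supp.trans hUc
  -- (3) `T` integral Noetherian regular excellent of dimension three
  haveI : IsIntegral T := hρ₁.isIntegral h𝓛₁ne
  haveI : IsProper ρ₁ := hρ₁.isProper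
  haveI : IsNoetherian T := by
    haveI : IsLocallyNoetherian T := LocallyOfFiniteType.isLocallyNoetherian ρ₁
    haveI : CompactSpace T := QuasiCompact.compactSpace_of_compactSpace ρ₁
    exact {}
  have hexcT : Scheme.IsExcellent T :=
    isExcellent_of_isRegular_of_isQuasiExcellent hTreg (Scheme.IsQuasiExcellent.of_locallyOfFiniteType ρ₁ hqe)
  have hdimT : topologicalKrullDim T = 3 :=
    (hρ₁.isBirational' h𝓛₁ne).topologicalKrullDim_eq_of_isProper.trans hdimX
  -- `B = ρ₁⁻¹{𝔪}`: closed and not everything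
  set B : Set T := ρ₁ ⁻¹' {IsLocalRing.closedPoint A} with hBdef
  have hBc : IsClosed B :=
    ((PrimeSpectrum.isClosed_singleton_iff_isMaximal _).mpr (IsLocalRing.maximalIdeal.isMaximal A)).preimage
      ρ₁.continuous
  have hgenU : genericPoint X ∈ (U : Set X) := by
    rw [hU, Scheme.mem_regularLocus]
    exact inferInstanceAs (IsRegularLocalRing X.functionField)
  have hBuniv : B ≠ Set.univ := by
    obtain ⟨t, ht⟩ := (ConcreteCategory.bijective_of_isIso (ρ₁ ∣_ U).base).2 ⟨genericPoint X, hgenU⟩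
    have htx : ρ₁ t.1 = genericPoint X := by
      have h1 := congrArg Subtype.val ht
      rwa [morphismRestrict_base_coe] at h1
    intro hB'
    have hmem : t.1 ∈ B := hB' ▸ Set.mem_univ _
    have hmem' : ρ₁ t.1 ∈ ({IsLocalRing.closedPoint A} : Set X) := hmem
    rw [htx] at hmem'
    exact hgen hmem'
  -- (4) STEP 2 on `(T, B)`
  obtain ⟨𝓛₂, X', ρ₂, -, h𝓛₂supp, hρ₂, hX'reg, hsnc⟩ :=
    EmbeddedSncThreefolds.embeddedSncThreefolds_of hP hCJS T hTreg hexcT hdimT B hBc hBuniv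
  -- (5) `ρ₂ ≫ ρ₁` is one blowing up along `𝓛 ≠ 0` supported in `{𝔪}`
  obtain ⟨𝓛, h𝓛, h𝓛supp⟩ :=
    IsBlowup.exists_isBlowup_comp_supported ρ₁ 𝓛₁ ρ₂ 𝓛₂ {IsLocalRing.closedPoint A} hρ₁ h𝓛₁pt hρ₂ h𝓛₂supp
  have h𝓛ne : 𝓛 ≠ ⊥ := by
    intro h0
    have hmem : genericPoint X ∈ (𝓛.support : Set X) := by rw [h0, support_bot]; trivial
    exact hgen (h𝓛supp hmem)
  have hpre : (ρ₂ ≫ ρ₁) ⁻¹' {IsLocalRing.closedPoint A} = ρ₂ ⁻¹' B := by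
    rw [hBdef]
    ext x
    simp only [Set.mem_preimage, Scheme.Hom.comp_apply]
  -- (6) COR D1
  exact hD p A X' (ρ₂ ≫ ρ₁) 𝓛 h𝓛ne h𝓛supp h𝓛 hX'reg (hpre ▸ hsnc)

end Summit.ResolutionOfSingularities.ResolutionOfSingularities.Theorems.FInjectiveMacaulayfication.GDDOfIsolatedDimThree

end
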